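import Mathlib
import HarnessLib
import Literature.Analysis.FluidPDE.VectorCalculus
import Literature.Analysis.FluidPDE.NSBoundedSpatialHolder
import Summits.NavierStokesRegularity.NavierStokesRegularity.Theorems.PoloidalWindowDoorPoloidalWindowRigidityClebschHead

/-!
# Route `PoloidalWindowDoor` (staged, nsreg-p1), crux `PoloidalWindowRigidity` (K2) — vortex-line bookkeeping:
# the Clebsch source `T` is constant along vortex lines, and the poloidal circulation identity

Cell ns-regularity-ideate, seat p7 (lead on K2; route-directed support for the open stub `stub_nonflatLiouville`,
landed `--supports` the door item until the route is born); seventh Clebsch file. These are the two exact LOCAL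
facts on which the lead's area-coordinate calculus of closed vortex lines rests (census CENSUS-K2G §9, «M7»):
every first-order term of the reduced `ψ`-equation is constant on vortex lines, and vertical averages of
horizontal `ψ`-differences are controlled by the velocity bound alone.

* `fderiv_T_curl_eq_zero` — for a profile of the stub's class (Type-I rate, continuity, Oseen-mild, div-free,
  poloidal along `e₂`, frozen constraint) with the time-dependent Clebsch potentials `φ, ψ` of
  `…ClebschDynamics` / `…ClebschHead` and `T := ∂ₜψ + (v·∇)ψ − Δψ`:  **`DT(y)[curl v(t,y)] = 0`** for every
  `t < 0`, `y` — `T` is constant along the vortex lines (the level curves of `ψ` in horizontal planes), with NO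
  generic-branch assumption. Algebra: by (E2) (`clebsch_T_equation`) `∂ᵢT = ∂₂ψ ∂ᵢv₂ − ∂₂v₂ ∂ᵢψ` (`i = 0,1`), so
  `∂₁ψ ∂₀T − ∂₀ψ ∂₁T = ∂₂ψ (∂₁ψ ∂₀v₂ − ∂₀ψ ∂₁v₂) = 0` by the frozen bracket (`frozen_bracket`); and
  `curl v = (∂₁ψ, −∂₀ψ, 0)`. Companion: `fderiv_apply_two_curl_eq_zero` (`Dv₂[curl v] = 0`, the frozen
  constraint itself in the same form) and `fderiv_stream_curl_eq_zero` (`Dψ[curl v] = 0`, tautological).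
* `integral_stream_sub_eq_circulation` (GENERIC) — if `V = ∇φ + ψ e₂` (`φ ∈ C¹`, `ψ`, `V` continuous), then for
  every base point `a`, HORIZONTAL displacement `d` (`d₂ = 0`) and height `h`:
  `∫₀ʰ (ψ(a + d + τe₂) − ψ(a + τe₂)) dτ = ∮_{∂R} V·dl`, the circulation of `V` around the vertical rectangle
  `R` with corners `a, a+d, a+d+he₂, a+he₂` (the flux of `curl V = ∇ψ × e₂` through `R`; Stokes' theorem for this
  rectangle, proved here by four applications of the fundamental theorem of calculus: the `∇φ`-parts telescope);
  `abs_integral_stream_sub_le` — hence `|∫₀ʰ (ψ(a+d+τe₂) − ψ(a+τe₂)) dτ| ≤ 2M(‖d‖ + h)` when `‖V‖ ≤ M`: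
  vertical AVERAGES over height `h = ‖d‖` of horizontal `ψ`-differences are bounded by `4M`, although pointwise
  differences may grow like `‖d‖ · sup|curl V|`.
* `abs_integral_stream_sub_le_of_profile` (CLASS) — the same for a slice `v t` of a profile with the Type-I rate
  `‖v(t,y)‖ ≤ C/√(−t)` and any Clebsch representation `v t = ∇φ + ψ e₂`: bound `2 (C/√(−t)) (‖d‖ + h)`.

WHAT THIS IS NOT: not a claim about Navier–Stokes regularity and not a proof of K2 — kernel bookkeeping for a
STAGED door route's open stub (bears_on LADDER-NS N0, rung N0-LocalTubeDoorPoloidal).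
-/

noncomputable section

-- the summit and its single sub-problem share the name (CONVENTIONS §1), as in every Theorems file
set_option linter.dupNamespace false

namespace Summit.NavierStokesRegularity.NavierStokesRegularity.Theorems.PoloidalWindowDoorPoloidalWindowRigidityClebschLoop

open Set Function MeasureTheory intervalIntegral
open scoped RealInnerProductSpace InnerProductSpace ContDiff Laplacian Interval
open Literature.Analysis Literature.Analysis.FluidPDE
open Summit.NavierStokesRegularity.NavierStokesRegularity.Theorems.PoloidalWindowDoorPoloidalWindowRigidityClebschVorticity
open Summit.NavierStokesRegularity.NavierStokesRegularity.Theorems.PoloidalWindowDoorPoloidalWindowRigidityClebsch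
open Summit.NavierStokesRegularity.NavierStokesRegularity.Theorems.PoloidalWindowDoorPoloidalWindowRigidityClebschDynamics
open Summit.NavierStokesRegularity.NavierStokesRegularity.Theorems.LocalSineTubeDoorProfileAlignedWindowRigidityAncient
open Literature.Analysis.FluidPDE.VerticalVorticityFree

/-! ### Generic: circulation around a vertical rectangle in Clebsch variables -/

section Generic

variable {V : EuclideanSpace ℝ (Fin 3) → EuclideanSpace ℝ (Fin 3)} {φ ψ : EuclideanSpace ℝ (Fin 3) → ℝ}

/-- Fundamental theorem of calculus along a straight line: `∫₀ʰ Dφ(p + τe)[e] dτ = φ(p + he) − φ(p)` for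
`φ ∈ C¹`. -/
theorem integral_fderiv_line (hφ : ContDiff ℝ 1 φ) (p e : EuclideanSpace ℝ (Fin 3)) (h : ℝ) :
    ∫ τ in (0 : ℝ)..h, fderiv ℝ φ (p + τ • e) e = φ (p + h • e) - φ p := by
  have hd : ∀ τ : ℝ, HasDerivAt (fun σ : ℝ => φ (p + σ • e)) (fderiv ℝ φ (p + τ • e) e) τ := by
    intro τ
    have hl : HasDerivAt (fun σ : ℝ => p + σ • e) e τ := by
      simpa using ((hasDerivAt_id τ).smul_const e).const_add p
    have hF : HasFDerivAt φ (fderiv ℝ φ (p + τ • e)) (p + τ • e) :=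
      ((hφ.differentiable one_ne_zero) _).hasFDerivAt
    exact hF.comp_hasDerivAt τ hl
  have hc : Continuous fun τ : ℝ => fderiv ℝ φ (p + τ • e) e :=
    ((hφ.continuous_fderiv one_ne_zero).comp (by fun_prop)).clm_apply continuous_const
  rw [integral_eq_sub_of_hasDerivAt (fun τ _ => hd τ) (hc.intervalIntegrable _ _)]
  simp

/-- For `V = ∇φ + ψ e₂` and a HORIZONTAL vector `d` (`d₂ = 0`): `⟪V(p), d⟫ = Dφ(p)[d]`. -/
theorem inner_eq_fderiv_of_horizontal (hrep : ∀ y, V y = gradient φ y + ψ y • EuclideanSpace.single 2 1)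
    {d : EuclideanSpace ℝ (Fin 3)} (hd : d 2 = 0) (p : EuclideanSpace ℝ (Fin 3)) :
    ⟪V p, d⟫_ℝ = fderiv ℝ φ p d := by
  rw [hrep p, inner_add_left, real_inner_smul_left, EuclideanSpace.inner_single_left, hd, gradient,
    InnerProductSpace.toDual_symm_apply]
  simp

/-- For `V = ∇φ + ψ e₂`: `⟪V(p), e₂⟫ = Dφ(p)[e₂] + ψ(p)`. -/
theorem inner_single_two_eq (hrep : ∀ y, V y = gradient φ y + ψ y • EuclideanSpace.single 2 1)
    (p : EuclideanSpace ℝ (Fin 3)) :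
    ⟪V p, EuclideanSpace.single 2 1⟫_ℝ = fderiv ℝ φ p (EuclideanSpace.single 2 1) + ψ p := by
  rw [hrep p, inner_add_left, real_inner_smul_left, EuclideanSpace.inner_single_left, gradient,
    InnerProductSpace.toDual_symm_apply]
  simp

/-- **Poloidal circulation identity (Stokes on a vertical rectangle, Clebsch form).** If `V = ∇φ + ψ e₂` with
`φ ∈ C¹` and `ψ` continuous, then for every `a`, horizontal `d` (`d₂ = 0`) and `h`:
`∫₀ʰ (ψ(a+d+τe₂) − ψ(a+τe₂)) dτ` equals the circulation of `V` around the rectangle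
`a → a+d → a+d+he₂ → a+he₂ → a` (bottom + right − top − left). -/
theorem integral_stream_sub_eq_circulation (hφ : ContDiff ℝ 1 φ) (hψ : Continuous ψ)
    (hrep : ∀ y, V y = gradient φ y + ψ y • EuclideanSpace.single 2 1)
    (a d : EuclideanSpace ℝ (Fin 3)) (hd : d 2 = 0) (h : ℝ) :
    ∫ τ in (0 : ℝ)..h, (ψ (a + d + τ • EuclideanSpace.single 2 1) - ψ (a + τ • EuclideanSpace.single 2 1)) =
      (∫ σ in (0 : ℝ)..1, ⟪V (a + σ • d), d⟫_ℝ) +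
        (∫ τ in (0 : ℝ)..h, ⟪V (a + d + τ • EuclideanSpace.single 2 1), EuclideanSpace.single 2 1⟫_ℝ) -
        (∫ σ in (0 : ℝ)..1, ⟪V (a + h • EuclideanSpace.single 2 1 + σ • d), d⟫_ℝ) -
        (∫ τ in (0 : ℝ)..h, ⟪V (a + τ • EuclideanSpace.single 2 1), EuclideanSpace.single 2 1⟫_ℝ) := by
  set e : EuclideanSpace ℝ (Fin 3) := EuclideanSpace.single 2 1 with he
  -- the four edges
  have hbot : ∫ σ in (0 : ℝ)..1, ⟪V (a + σ • d), d⟫_ℝ = φ (a + d) - φ a := by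
    simp_rw [inner_eq_fderiv_of_horizontal hrep hd]
    simpa using integral_fderiv_line hφ a d 1
  have htop : ∫ σ in (0 : ℝ)..1, ⟪V (a + h • e + σ • d), d⟫_ℝ = φ (a + h • e + d) - φ (a + h • e) := by
    simp_rw [inner_eq_fderiv_of_horizontal hrep hd]
    simpa using integral_fderiv_line hφ (a + h • e) d 1
  have hψc : ∀ p : EuclideanSpace ℝ (Fin 3), Continuous fun τ : ℝ => ψ (p + τ • e) := fun p =>
    hψ.comp (by fun_prop)
  have hφc : ∀ p : EuclideanSpace ℝ (Fin 3), Continuous fun τ : ℝ => fderiv ℝ φ (p + τ • e) e := fun p =>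
    ((hφ.continuous_fderiv one_ne_zero).comp (by fun_prop)).clm_apply continuous_const
  have hvert : ∀ p : EuclideanSpace ℝ (Fin 3),
      ∫ τ in (0 : ℝ)..h, ⟪V (p + τ • e), e⟫_ℝ = φ (p + h • e) - φ p + ∫ τ in (0 : ℝ)..h, ψ (p + τ • e) := by
    intro p
    simp_rw [he, inner_single_two_eq hrep]
    rw [integral_add ((hφc p).intervalIntegrable _ _) ((hψc p).intervalIntegrable _ _),
      integral_fderiv_line hφ p _ h]
  rw [integral_sub ((hψc (a + d)).intervalIntegrable _ _) ((hψc a).intervalIntegrable _ _), hbot, htop,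
    hvert (a + d), hvert a, show a + h • e + d = a + d + h • e from add_right_comm a (h • e) d]
  ring

/-- **Circulation bound.** With `‖V‖ ≤ M` everywhere, `φ ∈ C¹`, `ψ` and `V` continuous, `V = ∇φ + ψe₂`, `d`
horizontal and `h ≥ 0`: `|∫₀ʰ (ψ(a+d+τe₂) − ψ(a+τe₂)) dτ| ≤ 2M(‖d‖ + h)` (velocity bound × perimeter). -/
theorem abs_integral_stream_sub_le (hφ : ContDiff ℝ 1 φ) (hψ : Continuous ψ)
    (hrep : ∀ y, V y = gradient φ y + ψ y • EuclideanSpace.single 2 1)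
    {M : ℝ} (hM : ∀ y, ‖V y‖ ≤ M)
    (a d : EuclideanSpace ℝ (Fin 3)) (hd : d 2 = 0) {h : ℝ} (hh : 0 ≤ h) :
    |∫ τ in (0 : ℝ)..h, (ψ (a + d + τ • EuclideanSpace.single 2 1) - ψ (a + τ • EuclideanSpace.single 2 1))| ≤
      2 * M * (‖d‖ + h) := by
  set e : EuclideanSpace ℝ (Fin 3) := EuclideanSpace.single 2 1 with he
  have hne : ‖e‖ = 1 := by simp [he]
  rw [integral_stream_sub_eq_circulation hφ hψ hrep a d hd h]
  -- horizontal edges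
  have hH : ∀ p : EuclideanSpace ℝ (Fin 3), |∫ σ in (0 : ℝ)..1, ⟪V (p + σ • d), d⟫_ℝ| ≤ M * ‖d‖ := by
    intro p
    have hb : ∀ σ ∈ Ι (0 : ℝ) 1, ‖⟪V (p + σ • d), d⟫_ℝ‖ ≤ M * ‖d‖ := fun σ _ =>
      (norm_inner_le_norm _ _).trans (mul_le_mul_of_nonneg_right (hM _) (norm_nonneg _))
    have := norm_integral_le_of_norm_le_const hb
    simpa using this
  -- vertical edges
  have hV : ∀ p : EuclideanSpace ℝ (Fin 3), |∫ τ in (0 : ℝ)..h, ⟪V (p + τ • e), e⟫_ℝ| ≤ M * h := by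
    intro p
    have hb : ∀ τ ∈ Ι (0 : ℝ) h, ‖⟪V (p + τ • e), e⟫_ℝ‖ ≤ M := fun τ _ =>
      (norm_inner_le_norm _ _).trans (by rw [hne, mul_one]; exact hM _)
    have := norm_integral_le_of_norm_le_const hb
    simpa [abs_of_nonneg hh] using this
  have h1 := hH a
  have h2 := hV (a + d)
  have h3 := hH (a + h • e)
  have h4 := hV a
  have key : ∀ x y z w : ℝ, |x + y - z - w| ≤ |x| + |y| + |z| + |w| := by
    intro x y z w
    calc |x + y - z - w| ≤ |x + y - z| + |w| := abs_sub _ _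
      _ ≤ |x + y| + |z| + |w| := by gcongr; exact abs_sub _ _
      _ ≤ |x| + |y| + |z| + |w| := by gcongr; exact abs_add_le _ _
  calc _ ≤ _ := key _ _ _ _
    _ ≤ M * ‖d‖ + M * h + M * ‖d‖ + M * h := by gcongr
    _ = 2 * M * (‖d‖ + h) := by ring

end Generic

/-! ### The class of the stub: `T`, `v₂`, `ψ` are constant along vortex lines; circulation bound -/

section Profile

variable {C : ℝ} {v : ℝ → EuclideanSpace ℝ (Fin 3) → EuclideanSpace ℝ (Fin 3)}

/-- Tautology recorded for symmetry with the next two lemmas: with `curl v = (∂₁ψ, −∂₀ψ, 0)`,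
`Dψ[curl v] = ∂₁ψ ∂₀ψ − ∂₀ψ ∂₁ψ = 0` — `ψ` is constant along vortex lines. -/
theorem fderiv_stream_curl_eq_zero {s : ℝ} {ψ : EuclideanSpace ℝ (Fin 3) → ℝ}
    (hψ : ∀ y, curl (v s) y 0 = fderiv ℝ ψ y (EuclideanSpace.single 1 1) ∧
      curl (v s) y 1 = -fderiv ℝ ψ y (EuclideanSpace.single 0 1) ∧ curl (v s) y 2 = 0)
    (y : EuclideanSpace ℝ (Fin 3)) :
    fderiv ℝ ψ y (curl (v s) y) = 0 := by
  obtain ⟨h0, h1, h2⟩ := hψ y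
  rw [clf_apply_eq_sum3 (fderiv ℝ ψ y) (curl (v s) y), Fin.sum_univ_three, h0, h1, h2]
  ring

/-- **The frozen constraint along vortex lines**: `D(v₂)(y)[curl v(s,y)] = 0` is literally the first integral
`⟪Dv(s)(y)·curl v(s)(y), e₂⟫ = 0` (`stub_firstIntegral`): `v₂` is constant along vortex lines. -/
theorem fderiv_apply_two_curl_eq_zero {s : ℝ} (hV : ContDiff ℝ ∞ (v s))
    (hfi : ∀ y, ⟪fderiv ℝ (v s) y (curl (v s) y), EuclideanSpace.single 2 1⟫_ℝ = 0)
    (y : EuclideanSpace ℝ (Fin 3)) :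
    fderiv ℝ (fun z => v s z 2) y (curl (v s) y) = 0 := by
  have h := hfi y
  rw [EuclideanSpace.inner_single_right] at h
  rw [fderiv_apply_coord hV]
  simpa using h

/-- **The Clebsch source `T = ∂ₜψ + (v·∇)ψ − Δψ` is constant along vortex lines**: under EXACTLY the hypotheses
of `stub_nonflatLiouville` (class + poloidal along `e₂` + frozen constraint), with the time-dependent horizontal
line potential `φ` and `ψ = v₂ − ∂₂φ`, for every `t < 0` and `y`: `DT(t,·)(y)[curl v(t,y)] = 0`. By (E2)
(`…ClebschDynamics.clebsch_T_equation`) and the frozen bracket (`…Clebsch.frozen_bracket`):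
`∂₁ψ ∂₀T − ∂₀ψ ∂₁T = ∂₂ψ · (∂₁ψ ∂₀v₂ − ∂₀ψ ∂₁v₂) = 0`. (On the generic branch this is «`T = −∂_{x₂}H|_ψ` is
a function of `(ψ, x₂, t)`»; here no branch assumption is needed.) -/
theorem fderiv_T_curl_eq_zero (hrate : HasTypeITimeDecay C v)
    (hcont : ContinuousOn (uncurry v) (Iio (0 : ℝ) ×ˢ univ))
    (hmild : ∀ s t : ℝ, s < t → t < 0 → ∀ x,
      v t x = UnboundedOperators.heatExtension (v s) (t - s) x - oseenDuhamel 1 s v v t x)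
    (hdiv : ∀ t < 0, VectorCalculus.IsDivFree (v t))
    (hpol : ∀ s < 0, ∀ y, ⟪curl (v s) y, EuclideanSpace.single 2 1⟫_ℝ = 0)
    (hfi : ∀ s < 0, ∀ y, ⟪fderiv ℝ (v s) y (curl (v s) y), EuclideanSpace.single 2 1⟫_ℝ = 0)
    {φ ψ : ℝ → EuclideanSpace ℝ (Fin 3) → ℝ}
    (hφ : φ = fun (t : ℝ) (x : EuclideanSpace ℝ (Fin 3)) =>
      ∫ σ in (0 : ℝ)..1, ⟪v t (σ • (x - x 2 • (EuclideanSpace.single (2 : Fin 3) (1 : ℝ))) +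
        x 2 • (EuclideanSpace.single (2 : Fin 3) (1 : ℝ))), x - x 2 • (EuclideanSpace.single (2 : Fin 3) (1 : ℝ))⟫_ℝ)
    (hψ : ψ = fun t y => v t y 2 - fderiv ℝ (φ t) y (EuclideanSpace.single 2 1))
    {t : ℝ} (ht : t < 0) (y : EuclideanSpace ℝ (Fin 3)) :
    fderiv ℝ (fun z => deriv (fun s => ψ s z) t + (convect (v t) (ψ t) z - (Δ (ψ t)) z)) y (curl (v t) y) = 0 := by
  have hsm : ContDiffOn ℝ ∞ (uncurry v) (Iio (0 : ℝ) ×ˢ univ) :=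
    (analyticOnNhd_uncurry hcont (bdd_of_hasTypeITimeDecay hrate) hmild).contDiffOn_of_completeSpace
  have hV : ContDiff ℝ ∞ (v t) := IsSmoothSpaceTimeOn.contDiff_slice hsm ht
  have hc2 : ∀ z, curl (v t) z 2 = 0 := fun z => curl_two_eq_zero hpol ht z
  have hφt : φ t = fun x : EuclideanSpace ℝ (Fin 3) =>
      ∫ σ in (0 : ℝ)..1, ⟪v t (σ • (x - x 2 • (EuclideanSpace.single (2 : Fin 3) (1 : ℝ))) +
        x 2 • (EuclideanSpace.single (2 : Fin 3) (1 : ℝ))), x - x 2 • (EuclideanSpace.single (2 : Fin 3) (1 : ℝ))⟫_ℝ := by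
    rw [hφ]
  have hψt : ψ t = fun z => v t z 2 - fderiv ℝ (φ t) z (EuclideanSpace.single 2 1) := by rw [hψ]
  have hcomp : ∀ z, curl (v t) z 0 = fderiv ℝ (ψ t) z (EuclideanSpace.single 1 1) ∧
      curl (v t) z 1 = -fderiv ℝ (ψ t) z (EuclideanSpace.single 0 1) ∧ curl (v t) z 2 = 0 := by
    intro z; rw [hψt]; exact curl_apply_eq_fderiv_stream hV hc2 hφt z
  -- the frozen bracket and (E2)
  have hbr := frozen_bracket (hfi t ht) hcomp y
  obtain ⟨hE1, hE0⟩ := clebsch_T_equation hrate hcont hmild hdiv hpol hφ hψ ht y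
  obtain ⟨c0, c1, c2⟩ := hcomp y
  rw [clf_apply_eq_sum3 _ (curl (v t) y), Fin.sum_univ_three, c0, c1, c2, hE0, hE1]
  linear_combination (fderiv ℝ (ψ t) y (EuclideanSpace.single 2 1)) * hbr

/-- **Circulation bound on the class.** For a profile with the Type-I rate `‖v(t,y)‖ ≤ C/√(−t)` and any Clebsch
representation of the slice, `v t = ∇φ + ψ e₂` (`φ ∈ C¹`, `ψ` continuous, `v t` continuous — e.g. the
potentials of `…Clebsch.exists_clebsch_uncurry` / `…ClebschHead.exists_clebsch_system`), every base point `a`,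
horizontal displacement `d` and height `h ≥ 0`:
`|∫₀ʰ (ψ(a+d+τe₂) − ψ(a+τe₂)) dτ| ≤ 2 (C/√(−t)) (‖d‖ + h)` — the flux of the (horizontal) vorticity through a
vertical rectangle is bounded by the rate times the perimeter (the poloidal form of the planar circulation bound
in KNSS 2009, proof of Thm 5.1). -/
theorem abs_integral_stream_sub_le_of_profile (hrate : HasTypeITimeDecay C v) {t : ℝ} (ht : t < 0)
    {φ ψ : EuclideanSpace ℝ (Fin 3) → ℝ} (hφ : ContDiff ℝ 1 φ) (hψ : Continuous ψ)
    (hrep : ∀ y, v t y = gradient φ y + ψ y • EuclideanSpace.single 2 1)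
    (a d : EuclideanSpace ℝ (Fin 3)) (hd : d 2 = 0) {h : ℝ} (hh : 0 ≤ h) :
    |∫ τ in (0 : ℝ)..h, (ψ (a + d + τ • EuclideanSpace.single 2 1) - ψ (a + τ • EuclideanSpace.single 2 1))| ≤
      2 * (C / Real.sqrt (-t)) * (‖d‖ + h) :=
  abs_integral_stream_sub_le hφ hψ hrep (fun y => hrate t ht y) a d hd hh

end Profile

/-! ### Helicity density of a poloidal field = the planar Jacobian of its two Clebsch potentials

(Appended, nsreg-p7 gen 2.) For `V = ∇φ + ψ e₂` with `curl V = ∇ψ × e₂`: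
`⟪V, curl V⟫ = ∂₀φ ∂₁ψ − ∂₁φ ∂₀ψ = {φ, ψ}_h` — the helicity density (the hypothesis of nsreg-p1's door S11,
ROUND-11) of a POLOIDAL field is the planar Poisson bracket of the potentials; it vanishes identically iff, plane
by plane, the velocity potential is constant along the vortex lines (poloidal ∩ complex-lamellar stratum). -/

section Helicity

variable {V : EuclideanSpace ℝ (Fin 3) → EuclideanSpace ℝ (Fin 3)}

/-- **Helicity density in Clebsch variables (slice form).** For a smooth field with vanishing vertical vorticity,
with `φ` its horizontal line potential and `ψ = V₂ − ∂₂φ`: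
`⟪V(y), curl V(y)⟫ = ∂₀φ(y) ∂₁ψ(y) − ∂₁φ(y) ∂₀ψ(y)` (since `V₀ = ∂₀φ`, `V₁ = ∂₁φ`, `curl V = (∂₁ψ, −∂₀ψ, 0)`). -/
theorem inner_curl_eq_bracket (hV : ContDiff ℝ ∞ V) (hcurl : ∀ y, curl V y 2 = 0)
    {φ : EuclideanSpace ℝ (Fin 3) → ℝ}
    (hφ : φ = fun x : EuclideanSpace ℝ (Fin 3) =>
      ∫ σ in (0 : ℝ)..1, ⟪V (σ • (x - x 2 • (EuclideanSpace.single (2 : Fin 3) (1 : ℝ))) +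
        x 2 • (EuclideanSpace.single (2 : Fin 3) (1 : ℝ))), x - x 2 • (EuclideanSpace.single (2 : Fin 3) (1 : ℝ))⟫_ℝ)
    (y : EuclideanSpace ℝ (Fin 3)) :
    ⟪V y, curl V y⟫_ℝ =
      fderiv ℝ φ y (EuclideanSpace.single 0 1) *
          fderiv ℝ (fun z => V z 2 - fderiv ℝ φ z (EuclideanSpace.single 2 1)) y (EuclideanSpace.single 1 1) -
        fderiv ℝ φ y (EuclideanSpace.single 1 1) *
          fderiv ℝ (fun z => V z 2 - fderiv ℝ φ z (EuclideanSpace.single 2 1)) y (EuclideanSpace.single 0 1) := by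
  obtain ⟨c0, c1, c2⟩ := curl_apply_eq_fderiv_stream hV hcurl hφ y
  have h0 : fderiv ℝ φ y (EuclideanSpace.single 0 1) = V y 0 := by
    rw [hφ]; exact fderiv_linePotential_single hV hcurl y (Or.inl rfl)
  have h1 : fderiv ℝ φ y (EuclideanSpace.single 1 1) = V y 1 := by
    rw [hφ]; exact fderiv_linePotential_single hV hcurl y (Or.inr rfl)
  have hin : ⟪V y, curl V y⟫_ℝ = ∑ i, V y i * curl V y i := by
    simp only [PiLp.inner_apply, RCLike.inner_apply, conj_trivial]
    exact Finset.sum_congr rfl fun i _ => mul_comm _ _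
  rw [hin, Fin.sum_univ_three, c0, c1, c2, h0, h1]
  ring

variable {C : ℝ} {v : ℝ → EuclideanSpace ℝ (Fin 3) → EuclideanSpace ℝ (Fin 3)}

/-- **Helicity density of a poloidal profile (class form).** Under the class hypotheses of `stub_nonflatLiouville`
(Type-I rate, continuity, Oseen-mild, poloidal along `e₂`), with the time-dependent line potential `φ` and stream
function `ψ = v₂ − ∂₂φ` of the Clebsch kit: for every `t < 0` and `y`,
`⟪v(t,y), curl v(t,y)⟫ = ∂₀φ ∂₁ψ − ∂₁φ ∂₀ψ` — K2's class meets the helicity-free hypothesis of door S11 exactly on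
the stratum where `φ` is constant along vortex lines in every horizontal plane. -/
theorem inner_curl_eq_bracket_of_profile (hrate : HasTypeITimeDecay C v)
    (hcont : ContinuousOn (uncurry v) (Iio (0 : ℝ) ×ˢ univ))
    (hmild : ∀ s t : ℝ, s < t → t < 0 → ∀ x,
      v t x = UnboundedOperators.heatExtension (v s) (t - s) x - oseenDuhamel 1 s v v t x)
    (hpol : ∀ s < 0, ∀ y, ⟪curl (v s) y, EuclideanSpace.single 2 1⟫_ℝ = 0)
    {φ ψ : ℝ → EuclideanSpace ℝ (Fin 3) → ℝ}
    (hφ : φ = fun (t : ℝ) (x : EuclideanSpace ℝ (Fin 3)) =>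
      ∫ σ in (0 : ℝ)..1, ⟪v t (σ • (x - x 2 • (EuclideanSpace.single (2 : Fin 3) (1 : ℝ))) +
        x 2 • (EuclideanSpace.single (2 : Fin 3) (1 : ℝ))), x - x 2 • (EuclideanSpace.single (2 : Fin 3) (1 : ℝ))⟫_ℝ)
    (hψ : ψ = fun t y => v t y 2 - fderiv ℝ (φ t) y (EuclideanSpace.single 2 1))
    {t : ℝ} (ht : t < 0) (y : EuclideanSpace ℝ (Fin 3)) :
    ⟪v t y, curl (v t) y⟫_ℝ =
      fderiv ℝ (φ t) y (EuclideanSpace.single 0 1) * fderiv ℝ (ψ t) y (EuclideanSpace.single 1 1) -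
        fderiv ℝ (φ t) y (EuclideanSpace.single 1 1) * fderiv ℝ (ψ t) y (EuclideanSpace.single 0 1) := by
  have hsm : ContDiffOn ℝ ∞ (uncurry v) (Iio (0 : ℝ) ×ˢ univ) :=
    (analyticOnNhd_uncurry hcont (bdd_of_hasTypeITimeDecay hrate) hmild).contDiffOn_of_completeSpace
  have hV : ContDiff ℝ ∞ (v t) := IsSmoothSpaceTimeOn.contDiff_slice hsm ht
  have hc2 : ∀ z, curl (v t) z 2 = 0 := fun z => curl_two_eq_zero hpol ht z
  have hφt : φ t = fun x : EuclideanSpace ℝ (Fin 3) =>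
      ∫ σ in (0 : ℝ)..1, ⟪v t (σ • (x - x 2 • (EuclideanSpace.single (2 : Fin 3) (1 : ℝ))) +
        x 2 • (EuclideanSpace.single (2 : Fin 3) (1 : ℝ))), x - x 2 • (EuclideanSpace.single (2 : Fin 3) (1 : ℝ))⟫_ℝ := by
    rw [hφ]
  have hψt : ψ t = fun z => v t z 2 - fderiv ℝ (φ t) z (EuclideanSpace.single 2 1) := by rw [hψ]
  rw [hψt]
  exact inner_curl_eq_bracket hV hc2 hφt y

end Helicity

end Summit.NavierStokesRegularity.NavierStokesRegularity.Theorems.PoloidalWindowDoorPoloidalWindowRigidityClebschLoop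

end
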